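import Mathlib
import Literature.Analysis.Calculus.DihedralInvariantsFormal
import Literature.Analysis.Calculus.FlatZeroSectionValues
import Literature.Analysis.Calculus.FlatCubeRootDescent
import Literature.Analysis.Calculus.SymmetricGermCutoff

/-!
# Glaeser–Chevalley for `S₃`: smooth symmetric functions of three variables

Topic `Analysis/Calculus`. The smooth Newton theorem in three variables [Glaeser1963Newton,
Thm. II, «théorème de Newton différentiable»]: a smooth function of three real variables,
symmetric under all permutations, is a smooth function of the elementary symmetric polynomials
`e₁ = x₀ + x₁ + x₂`, `e₂ = x₀x₁ + x₀x₂ + x₁x₂`, `e₃ = x₀x₁x₂`. We prove it with values in a real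
Banach space `E` and with a finite-dimensional parameter `P` (one universe, as in
★ `WhitneyEvenFunctionSeveral`), and derive the germ form at a diagonal point (the shape consumed by
class-function constructions at a scalar corner).

Road («G″: cube first, then Whitney»). In the Lagrange resolvent coordinate
`w = x₀ + ωx₁ + ω²x₂ = a + ib` the symmetric group acts on the plane as the dihedral group `D₃`
(`w ↦ w̄`, `w ↦ ωw`) and the invariants are `u = |w|² = e₁² − 3e₂`,
`v = Re w³ = a³ − 3ab² = (2e₁³ − 9e₁e₂ + 27e₃)/2`. The planar theorem
`exists_contDiff_comp_dihedralInvariants` is: FORMAL part at the corner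
(★ `DihedralInvariantsFormal`: a smooth `G₀` with `Φ − G₀ ∘ (u,v)` flat along `a = b = 0`), then
VALUE-flat ⇒ JET-flat (★ `FlatZeroSectionValues`), then the FLAT `C₃`-descent `w ↦ w³` followed by
Whitney's even-function theorem in `Im w³` (★ `FlatCubeRootDescent`), GLOBALLY on `ℂ × P` — no
patching, no wall or regular-point analysis. The head `exists_contDiff_comp_esymm_three_of_forall_perm`
follows by the linear change `(a, b, m) ↔ x`; the germ∕ball form by the symmetric product cut-off
(★ `SymmetricGermCutoff`). The `n = 2` case is ★ `NewtonSymmetricTwo`.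

## References
* G. Glaeser, Fonctions composées différentiables, Ann. of Math. (2) 77 (1963) 193–209, Thm. II;
  announcement: Séminaire Lelong 5 (1962∕63), exp. 2, p. 4. (His proof: Fréchet-closedness of
  `θ^* 𝓔` + Whitney's extension and spectral theorems + Łojasiewicz; the present elementary road
  is Whitney-1943's «formal + flat» structure for the Weyl group `A₂`.)
* H. Whitney, Differentiable even functions, Duke Math. J. 10 (1943) 159–160.
-/

noncomputable section

open Set Function Filter Metric Topology
open scoped ContDiff

namespace Literature.Analysis.Calculus

universe u

variable {P : Type u} [NormedAddCommGroup P] [NormedSpace ℝ P] [FiniteDimensional ℝ P]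
  {E : Type u} [NormedAddCommGroup E] [NormedSpace ℝ E] [CompleteSpace E]

/-! ## The planar `D₃` theorem -/

/-- **Glaeser–Chevalley for the dihedral group `D₃` acting on the plane** (with parameters,
Banach-valued): a smooth `Φ : ℝ × ℝ × P → E` which is even in `b` and invariant under the rotation
by `2π/3` in `(a,b)` is a smooth function of `u = a² + b²`, `v = a³ − 3ab²` and the parameter —
globally. Formal part ★ `exists_contDiff_sub_comp_dihedralInvariants_isBigO`, jets
★ `iteratedFDeriv_zeroSection_eq_zero_of_isBigO`, flat part ★
`exists_contDiff_comp_dihedralInvariants_of_flat` (cube first, then Whitney).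
[cite: Glaeser1963Newton, Thm. II («théorème de Newton différentiable», n = 3; Sém. Lelong 5 exp. 2 p. 4)] -/
theorem exists_contDiff_comp_dihedralInvariants (Φ : ℝ × ℝ × P → E) (hΦ : ContDiff ℝ ∞ Φ)
    (heven : ∀ (a b : ℝ) (z : P), Φ (a, -b, z) = Φ (a, b, z))
    (hrot : ∀ (a b : ℝ) (z : P),
      Φ (-(1 / 2) * a - Real.sqrt 3 / 2 * b, Real.sqrt 3 / 2 * a - (1 / 2) * b, z) = Φ (a, b, z)) :
    ∃ G : ℝ × ℝ × P → E, ContDiff ℝ ∞ G ∧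
      ∀ (a b : ℝ) (z : P), Φ (a, b, z) = G (a ^ 2 + b ^ 2, a ^ 3 - 3 * a * b ^ 2, z) := by
  have h3 : Real.sqrt 3 * Real.sqrt 3 = 3 := Real.mul_self_sqrt (by norm_num)
  set π : ℝ × ℝ × P → ℝ × ℝ × P :=
    fun q => (q.1 ^ 2 + q.2.1 ^ 2, q.1 ^ 3 - 3 * q.1 * q.2.1 ^ 2, q.2.2) with hπ
  have hπc : ContDiff ℝ ∞ π := by simp only [hπ]; fun_prop
  have hπR : ∀ (a b : ℝ) (z : P),
      π (-(1 / 2) * a - Real.sqrt 3 / 2 * b, Real.sqrt 3 / 2 * a - (1 / 2) * b, z) = π (a, b, z) := by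
    intro a b z
    simp only [hπ]
    refine Prod.ext ?_ (Prod.ext ?_ rfl)
    · show _ = _; linear_combination ((a ^ 2 + b ^ 2) / 4) * h3
    · show _ = _
      linear_combination
        ((3 * a ^ 3 + 3 * Real.sqrt 3 * a ^ 2 * b - 9 * a * b ^ 2 - Real.sqrt 3 * b ^ 3) / 8) * h3
  have hπS : ∀ (a b : ℝ) (z : P), π (a, -b, z) = π (a, b, z) := by
    intro a b z
    simp only [hπ]
    refine Prod.ext ?_ (Prod.ext ?_ rfl)
    · show _ = _; ring
    · show _ = _; ring
  -- (C1) the formal part at the corner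
  obtain ⟨G₀, hG₀, hG₀flat⟩ :=
    exists_contDiff_sub_comp_dihedralInvariants_isBigO Φ hΦ heven hrot
  set Φ₁ : ℝ × ℝ × P → E := fun q => Φ q - G₀ (π q) with hΦ₁
  have hΦ₁c : ContDiff ℝ ∞ Φ₁ := by
    simp only [hΦ₁]
    exact hΦ.sub (hG₀.comp hπc)
  have heven₁ : ∀ (a b : ℝ) (z : P), Φ₁ (a, -b, z) = Φ₁ (a, b, z) := by
    intro a b z
    simp only [hΦ₁, heven a b z, hπS a b z]
  have hrot₁ : ∀ (a b : ℝ) (z : P),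
      Φ₁ (-(1 / 2) * a - Real.sqrt 3 / 2 * b, Real.sqrt 3 / 2 * a - (1 / 2) * b, z)
        = Φ₁ (a, b, z) := by
    intro a b z
    simp only [hΦ₁, hrot a b z, hπR a b z]
  -- (C2) pass to `ℂ × P`
  set L : ℂ × P → ℝ × ℝ × P := fun q => (q.1.re, q.1.im, q.2) with hL
  have hLc : ContDiff ℝ ∞ L :=
    (Complex.reCLM.contDiff.comp contDiff_fst).prodMk
      ((Complex.imCLM.contDiff.comp contDiff_fst).prodMk contDiff_snd)
  set f : ℂ × P → E := fun q => Φ₁ (L q) with hf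
  have hfc : ContDiff ℝ ∞ f := hΦ₁c.comp hLc
  have hω : Complex.exp (2 * Real.pi * Complex.I / 3) = ⟨-(1 / 2), Real.sqrt 3 / 2⟩ := by
    have h23 : (2 * Real.pi * Complex.I / 3 : ℂ) = ((2 * Real.pi / 3 : ℝ) : ℂ) * Complex.I := by
      push_cast; ring
    have hc : Real.cos (2 * Real.pi / 3) = -(1 / 2) := by
      rw [show 2 * Real.pi / 3 = Real.pi - Real.pi / 3 by ring, Real.cos_pi_sub,
        Real.cos_pi_div_three]
    have hs : Real.sin (2 * Real.pi / 3) = Real.sqrt 3 / 2 := by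
      rw [show 2 * Real.pi / 3 = Real.pi - Real.pi / 3 by ring, Real.sin_pi_sub,
        Real.sin_pi_div_three]
    rw [h23, Complex.exp_mul_I, ← Complex.ofReal_cos, ← Complex.ofReal_sin, hc, hs]
    apply Complex.ext <;> simp
  have hrotf : ∀ (w : ℂ) (z : P), f (Complex.exp (2 * Real.pi * Complex.I / 3) * w, z) = f (w, z) := by
    intro w z
    have hpt : L ((⟨-(1 / 2), Real.sqrt 3 / 2⟩ : ℂ) * w, z) =
        (-(1 / 2) * w.re - Real.sqrt 3 / 2 * w.im, Real.sqrt 3 / 2 * w.re - (1 / 2) * w.im, z) := by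
      simp only [hL, Complex.mul_re, Complex.mul_im]
      exact Prod.ext (by ring) (Prod.ext (by ring) rfl)
    show Φ₁ (L _) = Φ₁ (L _)
    rw [hω, hpt]
    exact hrot₁ w.re w.im z
  have hconjf : ∀ (w : ℂ) (z : P), f (starRingEnd ℂ w, z) = f (w, z) := by
    intro w z
    simp only [hf, hL, Complex.conj_re, Complex.conj_im]
    exact heven₁ w.re w.im z
  have hOf : ∀ (N : ℕ) (z : P), f =O[𝓝 ((0 : ℂ), z)] fun q : ℂ × P => ‖q.1‖ ^ N := by
    intro N z
    have hLz : Tendsto L (𝓝 ((0 : ℂ), z)) (𝓝 ((0 : ℝ), (0 : ℝ), z)) := by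
      have := hLc.continuous.tendsto ((0 : ℂ), z)
      simpa [hL] using this
    have h1 : f =O[𝓝 ((0 : ℂ), z)] fun q : ℂ × P => ‖((L q).1, (L q).2.1)‖ ^ N :=
      (hG₀flat z N).comp_tendsto hLz
    refine h1.trans ?_
    refine Asymptotics.IsBigO.of_bound 1 (Filter.Eventually.of_forall fun q => ?_)
    simp only [hL, one_mul, norm_pow, norm_norm]
    gcongr
    rw [Prod.norm_def]
    exact max_le (Complex.abs_re_le_norm q.1) (Complex.abs_im_le_norm q.1)
  have hflatf : ∀ (n : ℕ) (z : P), iteratedFDeriv ℝ n f ((0 : ℂ), z) = 0 :=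
    iteratedFDeriv_zeroSection_eq_zero_of_isBigO f hfc hOf
  -- (C3) flat `C₃`-descent + Whitney-even (brick D)
  obtain ⟨F, hF, hFf⟩ := exists_contDiff_comp_dihedralInvariants_of_flat f hfc hrotf hconjf hflatf
  refine ⟨fun y => F y + G₀ y, hF.add hG₀, fun a b z => ?_⟩
  have h1 : Φ (a, b, z) = Φ₁ (a, b, z) + G₀ (π (a, b, z)) := by simp only [hΦ₁, sub_add_cancel]
  have h2 : Φ₁ (a, b, z) = f (⟨a, b⟩, z) := by simp only [hf, hL]
  have h3' : (⟨a, b⟩ : ℂ) ^ 3 = ⟨a ^ 3 - 3 * a * b ^ 2, 3 * a ^ 2 * b - b ^ 3⟩ := by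
    rw [show (3 : ℕ) = 2 + 1 from rfl, pow_succ, pow_two]
    apply Complex.ext
    · simp only [Complex.mul_re, Complex.mul_im]; ring
    · simp only [Complex.mul_re, Complex.mul_im]; ring
  rw [h1, h2, hFf, h3', Complex.normSq_mk]
  simp only [hπ]
  have hab : a * a + b * b = a ^ 2 + b ^ 2 := by ring
  rw [hab]

/-! ## Heads -/

/-- **Glaeser–Chevalley for `S₃`** (G. Glaeser 1963, «théorème de Newton différentiable», the
case `n = 3`; with parameters and Banach values): a smooth `f : (Fin 3 → ℝ) × P → E`, symmetric
in the three real variables, is a smooth function of their elementary symmetric polynomials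
`e₁ = x₀ + x₁ + x₂`, `e₂ = x₀x₁ + x₀x₂ + x₁x₂`, `e₃ = x₀x₁x₂` (and the parameter).
[cite: Glaeser1963Newton, Thm. II (Ann. of Math. 77 (1963) 193–209; Sém. Lelong 5 (1962∕63) exp. 2 p. 4)] -/
theorem exists_contDiff_comp_esymm_three_of_forall_perm (f : (Fin 3 → ℝ) × P → E)
    (hf : ContDiff ℝ ∞ f)
    (hsymm : ∀ (σ : Equiv.Perm (Fin 3)) (x : Fin 3 → ℝ) (z : P), f (x ∘ σ, z) = f (x, z)) :
    ∃ g : (Fin 3 → ℝ) × P → E, ContDiff ℝ ∞ g ∧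
      ∀ (x : Fin 3 → ℝ) (z : P),
        f (x, z) = g (![x 0 + x 1 + x 2, x 0 * x 1 + x 0 * x 2 + x 1 * x 2, x 0 * x 1 * x 2], z) := by
  -- Lagrange resolvent coordinates: `x = m • 𝟙 + a • c₁ + b • c₂` with
  -- `a = x₀ − (x₁+x₂)/2`, `b = (√3/2)(x₁ − x₂)`, `m = (x₀+x₁+x₂)/3`.
  have h3 : Real.sqrt 3 * Real.sqrt 3 = 3 := Real.mul_self_sqrt (by norm_num)
  set c₁ : Fin 3 → ℝ := ![2 / 3, -(1 / 3), -(1 / 3)] with hc₁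
  set c₂ : Fin 3 → ℝ := ![0, Real.sqrt 3 / 3, -(Real.sqrt 3 / 3)] with hc₂
  set X : ℝ × ℝ × (ℝ × P) → (Fin 3 → ℝ) :=
    fun q i => q.2.2.1 + c₁ i * q.1 + c₂ i * q.2.1 with hX
  have hXc : ContDiff ℝ ∞ X := by
    refine contDiff_pi.2 fun i => ?_
    simp only [hX]
    fun_prop
  have hX0 : ∀ q : ℝ × ℝ × (ℝ × P), X q 0 = q.2.2.1 + 2 / 3 * q.1 := by
    intro q; simp [hX, hc₁, hc₂]
  have hX1 : ∀ q : ℝ × ℝ × (ℝ × P),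
      X q 1 = q.2.2.1 - 1 / 3 * q.1 + Real.sqrt 3 / 3 * q.2.1 := by
    intro q; simp [hX, hc₁, hc₂]; ring
  have hX2 : ∀ q : ℝ × ℝ × (ℝ × P),
      X q 2 = q.2.2.1 - 1 / 3 * q.1 - Real.sqrt 3 / 3 * q.2.1 := by
    intro q; simp [hX, hc₁, hc₂]; ring
  set Φ : ℝ × ℝ × (ℝ × P) → E := fun q => f (X q, q.2.2.2) with hΦ
  have hΦc : ContDiff ℝ ∞ Φ :=
    hf.comp (hXc.prodMk (contDiff_snd.comp (contDiff_snd.comp contDiff_snd)))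
  have hs0 : (Equiv.swap (1 : Fin 3) 2) 0 = 0 := by decide
  have hs1 : (Equiv.swap (1 : Fin 3) 2) 1 = 2 := by decide
  have hs2 : (Equiv.swap (1 : Fin 3) 2) 2 = 1 := by decide
  have hr0 : (finRotate 3).symm 0 = 2 := by decide
  have hr1 : (finRotate 3).symm 1 = 0 := by decide
  have hr2 : (finRotate 3).symm 2 = 1 := by decide
  have heven : ∀ (a b : ℝ) (z : ℝ × P), Φ (a, -b, z) = Φ (a, b, z) := by
    intro a b z
    have hx : X (a, -b, z) = X (a, b, z) ∘ (Equiv.swap (1 : Fin 3) 2) := by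
      funext i
      fin_cases i
      · show X (a, -b, z) 0 = X (a, b, z) ((Equiv.swap (1 : Fin 3) 2) 0)
        rw [hs0, hX0, hX0]
      · show X (a, -b, z) 1 = X (a, b, z) ((Equiv.swap (1 : Fin 3) 2) 1)
        rw [hs1, hX1, hX2]; ring
      · show X (a, -b, z) 2 = X (a, b, z) ((Equiv.swap (1 : Fin 3) 2) 2)
        rw [hs2, hX2, hX1]; ring
    simp only [hΦ, hx]
    exact hsymm _ _ _
  have hrot : ∀ (a b : ℝ) (z : ℝ × P),
      Φ (-(1 / 2) * a - Real.sqrt 3 / 2 * b, Real.sqrt 3 / 2 * a - (1 / 2) * b, z) = Φ (a, b, z) := by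
    intro a b z
    have hx : X (-(1 / 2) * a - Real.sqrt 3 / 2 * b, Real.sqrt 3 / 2 * a - (1 / 2) * b, z) =
        X (a, b, z) ∘ (finRotate 3).symm := by
      funext i
      fin_cases i
      · show X _ 0 = X (a, b, z) ((finRotate 3).symm 0)
        rw [hr0, hX0, hX2]; ring
      · show X _ 1 = X (a, b, z) ((finRotate 3).symm 1)
        rw [hr1, hX1, hX0]; linear_combination (a / 6) * h3
      · show X _ 2 = X (a, b, z) ((finRotate 3).symm 2)
        rw [hr2, hX2, hX1]; linear_combination (-(a / 6)) * h3
    simp only [hΦ, hx]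
    exact hsymm _ _ _
  obtain ⟨G, hG, hGΦ⟩ := exists_contDiff_comp_dihedralInvariants Φ hΦc heven hrot
  refine ⟨fun ez => G (ez.1 0 ^ 2 - 3 * ez.1 1,
      (2 * ez.1 0 ^ 3 - 9 * ez.1 0 * ez.1 1 + 27 * ez.1 2) / 2, (ez.1 0 / 3, ez.2)), ?_, ?_⟩
  · refine hG.comp ?_
    fun_prop
  · intro x z
    have hx : X (x 0 - (x 1 + x 2) / 2, Real.sqrt 3 / 2 * (x 1 - x 2),
        ((x 0 + x 1 + x 2) / 3, z)) = x := by
      funext i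
      fin_cases i
      · show X _ 0 = x 0
        rw [hX0]; ring
      · show X _ 1 = x 1
        rw [hX1]; linear_combination ((x 1 - x 2) / 6) * h3
      · show X _ 2 = x 2
        rw [hX2]; linear_combination (-((x 1 - x 2) / 6)) * h3
    have key := hGΦ (x 0 - (x 1 + x 2) / 2) (Real.sqrt 3 / 2 * (x 1 - x 2))
      ((x 0 + x 1 + x 2) / 3, z)
    simp only [hΦ, hx] at key
    rw [key]
    simp only [Matrix.cons_val_zero, Matrix.cons_val_one, Matrix.cons_val_two, Matrix.head_cons,
      Matrix.tail_cons]
    congr 1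
    refine Prod.ext ?_ (Prod.ext ?_ (Prod.ext ?_ rfl))
    · show _ = _; linear_combination ((x 1 - x 2) ^ 2 / 4) * h3
    · show _ = _
      linear_combination (-(3 / 4) * (x 0 - (x 1 + x 2) / 2) * (x 1 - x 2) ^ 2) * h3
    · show _ = _; ring

/-- **Glaeser–Chevalley for `S₃`, germ form at a diagonal point** (the shape consumed by corner
constructions): a function smooth on a sup-ball about `(t, t, t)` (such balls are permutation
stable) and symmetric there is, on a smaller ball, a smooth function of `(e₁, e₂, e₃)` (and the
parameter). From the global head by the symmetric product cut-off
★ `exists_contDiff_comp_esymm_three_of_forall_perm_ball`.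
[cite: Glaeser1963Newton, Thm. II (n = 3)] -/
theorem exists_contDiff_comp_esymm_three_of_forall_perm_nhds (f : (Fin 3 → ℝ) × P → E) (t : ℝ)
    {r : ℝ} (hr : 0 < r) (hf : ContDiffOn ℝ ∞ f (Metric.ball (fun _ => t) r ×ˢ Set.univ))
    (hsymm : ∀ (σ : Equiv.Perm (Fin 3)), ∀ x ∈ Metric.ball (fun _ : Fin 3 => t) r, ∀ z : P,
      f (x ∘ σ, z) = f (x, z)) :
    ∃ g : (Fin 3 → ℝ) × P → E, ContDiff ℝ ∞ g ∧ ∃ r' > 0,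
      ∀ x ∈ Metric.ball (fun _ : Fin 3 => t) r', ∀ z : P,
        f (x, z) = g (![x 0 + x 1 + x 2, x 0 * x 1 + x 0 * x 2 + x 1 * x 2, x 0 * x 1 * x 2], z) :=
  exists_contDiff_comp_esymm_three_of_forall_perm_ball
    (fun f hf hs => exists_contDiff_comp_esymm_three_of_forall_perm f hf hs) f t hr hf hsymm

/-- **Glaeser–Chevalley for `S₃`, parameter-free form**: a smooth symmetric `f : (Fin 3 → ℝ) → E`
is a smooth function of `(e₁, e₂, e₃)`. [cite: Glaeser1963Newton, Thm. II (n = 3)] -/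
theorem exists_contDiff_comp_esymm_three_of_forall_perm' {E' : Type} [NormedAddCommGroup E']
    [NormedSpace ℝ E'] [CompleteSpace E'] (f : (Fin 3 → ℝ) → E') (hf : ContDiff ℝ ∞ f)
    (hsymm : ∀ (σ : Equiv.Perm (Fin 3)) (x : Fin 3 → ℝ), f (x ∘ σ) = f x) :
    ∃ g : (Fin 3 → ℝ) → E', ContDiff ℝ ∞ g ∧
      ∀ x : Fin 3 → ℝ,
        f x = g ![x 0 + x 1 + x 2, x 0 * x 1 + x 0 * x 2 + x 1 * x 2, x 0 * x 1 * x 2] := by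
  obtain ⟨g, hg, hfg⟩ := exists_contDiff_comp_esymm_three_of_forall_perm (P := PUnit) (E := E')
    (fun q => f q.1) (hf.comp contDiff_fst) (fun σ x _ => hsymm σ x)
  exact ⟨fun e => g (e, PUnit.unit), hg.comp (contDiff_id.prodMk contDiff_const),
    fun x => hfg x PUnit.unit⟩

end Literature.Analysis.Calculus
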